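import Literature.NumberTheory.EllipticCurves.ModularFormsGamma0FreeModule
import Literature.NumberTheory.EllipticCurves.ModularCurveGamma0IndexProofs
import Literature.NumberTheory.EllipticCurves.ModularCurveEllipticPointsProofs
import HarnessLib

/-!
# The level `±Γ₁(N)`: the subgroup, its index `φ(N)μ/2`, `T, -1 ∈ ±Γ₁(N)`, and
# `M_k(±Γ₁(N)) = M_k(Γ₁(N))` for even `k`

For the free-module (Gannon) route to the dimension of `M_k(Γ₁(N))` in even weights
(`ModularFormsLevelFreeModule`, `ModularFormsGamma1ExplicitForms`, and the `Γ₀(N)` model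
`ModularFormsGamma0FreeModule` / `…Rank` / `…Genus` / `…Dimension`) the natural level is not
`Γ₁(N)` — which misses `-1` for `N ≥ 3`, so that its coset space in `SL₂(ℤ)` double-counts the
cusps and the conjugate determinant of even-weight forms vanishes identically — but

  `±Γ₁(N) = {γ ∈ SL₂(ℤ) | γ ∈ Γ₁(N) ∨ -γ ∈ Γ₁(N)}`      (`Gamma1pm N`),

the level of Shimura 1971, §3.5 (`Γ' ⊇ {±1}`) with `M_k(±Γ₁(N)) = M_k(Γ₁(N))` for even `k`. This
file provides it as the tree's `adjoinNegI (Gamma1 N)` (`ModularCurveProofs`, Diamond–Shurman's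
`{±I}Γ`), abbreviated `Gamma1pm N`, with the facts the route consumes:

* `gamma1_le_gamma1pm`, `gamma1pm_le_gamma0`, `neg_one_mem_gamma1pm`, `T_mem_gamma1pm`,
  `mem_gamma1pm_iff` (`γ ∈ Γ₀(N)` with lower-right entry `≡ ±1`); the instances
  `(Gamma1pm N).FiniteIndex` and `Fact (T ∈ Gamma1pm N)` (the hypotheses of
  `ModularFormsLevelFreeModule`);
* `neg_one_not_mem_gamma1` (`N ≥ 3`), `relIndex_gamma1_gamma1pm` (`[±Γ₁(N) : Γ₁(N)] = 2`, via the
  sign homomorphism `±Γ₁(N) → ℤˣ` with kernel `Γ₁(N)`), **`two_mul_index_gamma1pm`**: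
  `2 [SL₂(ℤ) : ±Γ₁(N)] = [SL₂(ℤ) : Γ₁(N)] = φ(N) [SL₂(ℤ) : Γ₀(N)]` (`N ≥ 3`; tree
  `relIndex_gamma1_gamma0`, `index_gamma0_eq_gamma0Index_holds`);
* `formSpace_gamma1pm_eq_of_even` — **`M_k(±Γ₁(N)) = M_k(Γ₁(N))` for even `k`** (as spaces of
  functions; `f ∣_k (-γ) = f ∣_k γ` in even weight).

* `conj_S_not_mem_gamma1pm`, `conj_ST_not_mem_gamma1pm`, `card_fixed_S_gamma1pm`,
  `card_fixed_ST_gamma1pm` — **no elliptic points**: no conjugate of `S` (resp. `ST`) lies in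
  `±Γ₁(N)` for `N ≥ 3` (resp. `N ≥ 4`) (traces `0`, `1` versus `±2 (mod N)`), so no coset of
  `SL₂(ℤ)/±Γ₁(N)` is fixed by `S` or `ST` (`ν₂ = ν₃ = 0`, the fixed-coset counts of the elliptic
  constraints of `ModularFormsGamma0Rank`).

Everything is proved; no named facts. Deliberately not here: the coset space `SL₂(ℤ)/±Γ₁(N)`
as `(SL₂(ℤ)/Γ₀(N)) × (ℤ/Nℤ)ˣ/±1` and the cusps (next files).

## References

* G. Shimura, *Introduction to the arithmetic theory of automorphic functions*, Publ. Math. Soc.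
  Japan 11 (1971), §1.6 (Prop. 1.43) and §3.5 (levels `Γ'` with `-1 ∈ Γ'`; `Γ₁(N){±1}`).
* F. Diamond, J. Shurman, *A first course in modular forms*, GTM 228 (2005), §1.2, Ex. 1.2.3
  (indices of `Γ₀(N)`, `Γ₁(N)`), §3.8–3.9 (`±Γ` and dimension formulas in even weight).
-/

noncomputable section

open UpperHalfPlane hiding I
open ModularForm Complex Matrix.SpecialLinearGroup CongruenceSubgroup
open scoped MatrixGroups ModularForm

namespace Literature.NumberTheory.EllipticCurves.ModularForms

section Def

variable (N : ℕ)

/-- **The level `±Γ₁(N) = Γ₁(N) ∪ (-Γ₁(N)) ≤ SL₂(ℤ)`** (Shimura's `Γ₁(N){±1}`), as the tree's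
`adjoinNegI (Gamma1 N)` (`ModularCurveProofs`). [cite: Shimura1971, §3.5] -/
abbrev Gamma1pm : Subgroup SL(2, ℤ) := adjoinNegI (Gamma1 N)

variable {N}

/-- Membership in `±Γ₁(N)`. [folklore] -/
theorem mem_gamma1pm {γ : SL(2, ℤ)} : γ ∈ Gamma1pm N ↔ γ ∈ Gamma1 N ∨ -γ ∈ Gamma1 N := Iff.rfl

variable (N)

/-- `Γ₁(N) ≤ ±Γ₁(N)`. [folklore] -/
theorem gamma1_le_gamma1pm : Gamma1 N ≤ Gamma1pm N := le_adjoinNegI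

/-- `-1 ∈ ±Γ₁(N)`. [folklore] -/
theorem neg_one_mem_gamma1pm : (-1 : SL(2, ℤ)) ∈ Gamma1pm N := neg_one_mem_adjoinNegI

/-- `T ∈ ±Γ₁(N)`. [folklore] -/
theorem T_mem_gamma1pm : ModularGroup.T ∈ Gamma1pm N := by
  left
  rw [Gamma1_mem]
  simp [ModularGroup.T]

/-- `±Γ₁(N) ≤ Γ₀(N)` (`-1 ∈ Γ₀(N)`). [folklore] -/
theorem gamma1pm_le_gamma0 : Gamma1pm N ≤ Gamma0 N := by
  rintro γ (h | h)
  · exact Gamma1_in_Gamma0 N h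
  · have : γ = -1 * -γ := by simp
    rw [this]
    exact mul_mem (by simp [Gamma0_mem]) (Gamma1_in_Gamma0 N h)

/-- **`γ ∈ ±Γ₁(N)` iff `γ ∈ Γ₀(N)` and its lower-right entry is `≡ ±1 (mod N)`.** [folklore] -/
theorem mem_gamma1pm_iff {γ : SL(2, ℤ)} : γ ∈ Gamma1pm N ↔
    ((γ 1 0 : ℤ) : ZMod N) = 0 ∧ (((γ 1 1 : ℤ) : ZMod N) = 1 ∨ ((γ 1 1 : ℤ) : ZMod N) = -1) := by
  have hdet : (γ 0 0 : ℤ) * γ 1 1 - γ 0 1 * γ 1 0 = 1 := by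
    have := Matrix.SpecialLinearGroup.det_coe γ
    rwa [Matrix.det_fin_two] at this
  have hdet' : ((γ 0 0 : ℤ) : ZMod N) * ((γ 1 1 : ℤ) : ZMod N) -
      ((γ 0 1 : ℤ) : ZMod N) * ((γ 1 0 : ℤ) : ZMod N) = 1 := by
    exact_mod_cast congrArg ((↑) : ℤ → ZMod N) hdet
  constructor
  · rintro (h | h)
    · rw [Gamma1_mem] at h
      exact ⟨h.2.2, Or.inl h.2.1⟩
    · rw [Gamma1_mem] at h
      simp only [Matrix.SpecialLinearGroup.coe_neg, Matrix.neg_apply, Int.cast_neg,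
        neg_eq_zero] at h
      exact ⟨h.2.2, Or.inr (by linear_combination -h.2.1)⟩
  · rintro ⟨hc, hd | hd⟩
    · left
      rw [Gamma1_mem]
      refine ⟨?_, hd, hc⟩
      have := hdet'
      rw [hd, hc, mul_one, mul_zero, sub_zero] at this
      exact this
    · right
      rw [Gamma1_mem]
      simp only [Matrix.SpecialLinearGroup.coe_neg, Matrix.neg_apply, Int.cast_neg, neg_eq_zero]
      refine ⟨?_, by rw [hd, neg_neg], hc⟩
      have := hdet'
      rw [hd, hc, mul_neg, mul_one, mul_zero, sub_zero] at this
      exact this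

/-- `±Γ₁(N)` has finite index in `SL₂(ℤ)`. [folklore] -/
instance finiteIndex_gamma1pm [NeZero N] : (Gamma1pm N).FiniteIndex :=
  Subgroup.finiteIndex_of_le (gamma1_le_gamma1pm N)

/-- `T ∈ ±Γ₁(N)`, as the `Fact` consumed by `ModularFormsLevelFreeModule`. [folklore] -/
instance fact_T_mem_gamma1pm : Fact (ModularGroup.T ∈ Gamma1pm N) := ⟨T_mem_gamma1pm N⟩

end Def

/-! ### The index: `2[SL₂(ℤ) : ±Γ₁(N)] = [SL₂(ℤ) : Γ₁(N)] = φ(N)μ` (`N ≥ 3`) -/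

section Index

variable (N : ℕ)

/-- `-1 ∉ Γ₁(N)` for `N ≥ 3` (its upper-left entry is `-1 ≢ 1`). [folklore] -/
theorem neg_one_not_mem_gamma1 (hN : 3 ≤ N) : (-1 : SL(2, ℤ)) ∉ Gamma1 N := by
  intro h
  rw [Gamma1_mem] at h
  have h1 : (((-1 : SL(2, ℤ)) 0 0 : ℤ) : ZMod N) = -1 := by simp
  rw [h1] at h
  have h2 : (2 : ZMod N) = 0 := by linear_combination -h.1
  have hdvd : N ∣ 2 := (ZMod.natCast_eq_zero_iff 2 N).mp (by exact_mod_cast h2)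
  have := Nat.le_of_dvd (by norm_num) hdvd
  omega

/-- For `N ≥ 3`, `γ` and `-γ` are not both in `Γ₁(N)`. [folklore] -/
theorem not_mem_gamma1_of_neg_mem (hN : 3 ≤ N) {γ : SL(2, ℤ)} (h : -γ ∈ Gamma1 N) :
    γ ∉ Gamma1 N := by
  intro h'
  apply neg_one_not_mem_gamma1 N hN
  have : (-1 : SL(2, ℤ)) = -γ * γ⁻¹ := by simp
  rw [this]
  exact mul_mem h (inv_mem h')

open scoped Classical in
/-- **The sign homomorphism `±Γ₁(N) → ℤˣ`** (`γ ↦ 1` on `Γ₁(N)`, `↦ -1` on `-Γ₁(N)`), `N ≥ 3`.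
[folklore] -/
def gamma1pmSign (hN : 3 ≤ N) : Gamma1pm N →* ℤˣ where
  toFun γ := if (γ : SL(2, ℤ)) ∈ Gamma1 N then 1 else -1
  map_one' := by simp [one_mem]
  map_mul' := by
    rintro ⟨a, ha⟩ ⟨b, hb⟩
    simp only [Subgroup.coe_mul]
    rcases ha with ha | ha <;> rcases hb with hb | hb
    · rw [if_pos (mul_mem ha hb), if_pos ha, if_pos hb, one_mul]
    · have hab : a * b ∉ Gamma1 N := fun h ↦ not_mem_gamma1_of_neg_mem N hN hb
        (by simpa using mul_mem (inv_mem ha) h)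
      rw [if_neg hab, if_pos ha, if_neg (not_mem_gamma1_of_neg_mem N hN hb), one_mul]
    · have hab : a * b ∉ Gamma1 N := fun h ↦ not_mem_gamma1_of_neg_mem N hN ha
        (by simpa using mul_mem h (inv_mem hb))
      rw [if_neg hab, if_neg (not_mem_gamma1_of_neg_mem N hN ha), if_pos hb, mul_one]
    · have hab : a * b ∈ Gamma1 N := by
        rw [show a * b = -a * -b by simp]
        exact mul_mem ha hb
      rw [if_pos hab, if_neg (not_mem_gamma1_of_neg_mem N hN ha),
        if_neg (not_mem_gamma1_of_neg_mem N hN hb)]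
      norm_num

open scoped Classical in
/-- The kernel of the sign homomorphism is `Γ₁(N)`. [folklore] -/
theorem ker_gamma1pmSign (hN : 3 ≤ N) :
    (gamma1pmSign N hN).ker = (Gamma1 N).subgroupOf (Gamma1pm N) := by
  ext ⟨γ, hγ⟩
  rw [MonoidHom.mem_ker, Subgroup.mem_subgroupOf]
  simp only [gamma1pmSign, MonoidHom.coe_mk, OneHom.coe_mk]
  constructor
  · intro h
    by_contra hn
    rw [if_neg hn] at h
    norm_num at h
  · intro h
    rw [if_pos h]

/-- The sign homomorphism is onto (`-1 ↦ -1`). [folklore] -/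
theorem gamma1pmSign_surjective (hN : 3 ≤ N) : Function.Surjective (gamma1pmSign N hN) := by
  classical
  intro u
  rcases Int.units_eq_one_or u with rfl | rfl
  · exact ⟨1, map_one _⟩
  · refine ⟨⟨-1, neg_one_mem_gamma1pm N⟩, ?_⟩
    simp only [gamma1pmSign, MonoidHom.coe_mk, OneHom.coe_mk]
    rw [if_neg (neg_one_not_mem_gamma1 N hN)]

/-- **`[±Γ₁(N) : Γ₁(N)] = 2`** for `N ≥ 3`. [folklore] -/
theorem relIndex_gamma1_gamma1pm (hN : 3 ≤ N) : (Gamma1 N).relIndex (Gamma1pm N) = 2 := by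
  rw [Subgroup.relIndex, ← ker_gamma1pmSign N hN, Subgroup.index_ker,
    MonoidHom.range_eq_top.mpr (gamma1pmSign_surjective N hN), Subgroup.card_top,
    Nat.card_eq_fintype_card]
  rfl

/-- **`2 · [SL₂(ℤ) : ±Γ₁(N)] = [SL₂(ℤ) : Γ₁(N)]`** for `N ≥ 3`. [folklore] -/
theorem two_mul_index_gamma1pm_eq (hN : 3 ≤ N) :
    2 * (Gamma1pm N).index = (Gamma1 N).index := by
  have h := Subgroup.relIndex_mul_index (gamma1_le_gamma1pm N)
  rwa [relIndex_gamma1_gamma1pm N hN] at h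

/-- **`2 · [SL₂(ℤ) : ±Γ₁(N)] = φ(N) · [SL₂(ℤ) : Γ₀(N)] = φ(N) μ`** for `N ≥ 3`
(`[SL₂(ℤ) : Γ₁(N)] = [SL₂(ℤ) : Γ₀(N)][Γ₀(N) : Γ₁(N)]`, tree `relIndex_gamma1_gamma0` and
`index_gamma0_eq_gamma0Index_holds`). [cite: DiamondShurman2005, Ex. 1.2.3] -/
theorem two_mul_index_gamma1pm [NeZero N] (hN : 3 ≤ N) :
    2 * (Gamma1pm N).index = N.totient * gamma0Index N := by
  rw [two_mul_index_gamma1pm_eq N hN, ← Subgroup.relIndex_mul_index (Gamma1_in_Gamma0 N),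
    relIndex_gamma1_gamma0 N]
  congr 1
  exact index_gamma0_eq_gamma0Index_holds N

end Index

/-! ### Even weights: `M_k(±Γ₁(N)) = M_k(Γ₁(N))` -/

section EvenWeight

variable (N : ℕ) [NeZero N] {k : ℤ}

omit [NeZero N] in
/-- In even weight, `f ∣_k (-γ) = f ∣_k γ` for `γ ∈ SL₂(ℤ)`. [folklore] -/
theorem slash_neg_of_even (hk : Even k) (f : ℍ → ℂ) (γ : SL(2, ℤ)) :
    f ∣[k] (-γ) = f ∣[k] γ := by
  funext z
  rw [ModularForm.SL_slash_apply, ModularForm.SL_slash_apply, ModularGroup.SL_neg_smul]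
  congr 1
  have h1 : denom (↑(-γ) : GL (Fin 2) ℝ) (z : ℂ) = -denom (γ : GL (Fin 2) ℝ) (z : ℂ) := by
    simp [denom]
    ring
  rw [h1, (hk.neg).neg_zpow]

/-- **`M_k(±Γ₁(N)) = M_k(Γ₁(N))` for even `k`** (as spaces of functions): a weight-`k` form on
`Γ₁(N)` is invariant under `-γ`, `γ ∈ Γ₁(N)`, since `f ∣_k (-γ) = f ∣_k γ`.
[cite: Shimura1971, §3.5 (M_k(Γ') for Γ' ∋ -1)] -/
theorem formSpace_gamma1pm_eq_of_even (hk : Even k) :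
    formSpace (Gamma1pm N) k = formSpace (Gamma1 N) k := by
  refine le_antisymm (formSpace_mono (Subgroup.map_mono (gamma1_le_gamma1pm N))) ?_
  intro f hf
  rw [mem_formSpace_iff] at hf ⊢
  refine ⟨hf.1, ?_, hf.2.2⟩
  rintro _ ⟨γ, hγ, rfl⟩
  rcases hγ with hγ | hγ
  · exact hf.2.1 _ ⟨γ, hγ, rfl⟩
  · have h : f ∣[k] (-γ) = f := hf.2.1 _ ⟨-γ, hγ, rfl⟩
    rw [slash_neg_of_even hk] at h
    exact h

end EvenWeight

/-! ### No elliptic points: no coset of `SL₂(ℤ)/±Γ₁(N)` is fixed by `S` (`N ≥ 3`) or `ST` (`N ≥ 4`) -/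

section Elliptic

variable (N : ℕ)

/-- The trace of an element of `±Γ₁(N)` is `≡ ±2 (mod N)`. [folklore] -/
theorem trace_mem_gamma1pm {γ : SL(2, ℤ)} (hγ : γ ∈ Gamma1pm N) :
    ((γ 0 0 + γ 1 1 : ℤ) : ZMod N) = 2 ∨ ((γ 0 0 + γ 1 1 : ℤ) : ZMod N) = -2 := by
  rcases hγ with h | h
  · rw [Gamma1_mem] at h
    left
    push_cast
    rw [h.1, h.2.1]
    norm_num
  · rw [Gamma1_mem] at h
    simp only [Matrix.SpecialLinearGroup.coe_neg, Matrix.neg_apply, Int.cast_neg] at h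
    right
    push_cast
    linear_combination -h.1 - h.2.1

/-- The trace of a conjugate `g⁻¹hg` is the trace of `h`. [folklore] -/
theorem trace_conj_eq (g h : SL(2, ℤ)) :
    ((g⁻¹ * h * g : SL(2, ℤ)) 0 0 : ℤ) + (g⁻¹ * h * g : SL(2, ℤ)) 1 1 = (h 0 0 : ℤ) + h 1 1 := by
  have h1 : ∀ A : SL(2, ℤ), (A 0 0 : ℤ) + A 1 1 = Matrix.trace (A : Matrix (Fin 2) (Fin 2) ℤ) :=
    fun A ↦ by rw [Matrix.trace_fin_two]
  rw [h1, h1, Matrix.SpecialLinearGroup.coe_mul, Matrix.SpecialLinearGroup.coe_mul,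
    Matrix.trace_mul_cycle, ← Matrix.SpecialLinearGroup.coe_mul, mul_inv_cancel,
    Matrix.SpecialLinearGroup.coe_one, Matrix.one_mul]

/-- **No conjugate of `S` lies in `±Γ₁(N)` for `N ≥ 3`** (its trace is `0 ≢ ±2`): `±Γ₁(N)` has
no elliptic elements of order `4`. [cite: Shimura1971, §1.6 (Prop. 1.43: ν₂ = 0 for Γ₁(N), N ≥ 3)] -/
theorem conj_S_not_mem_gamma1pm (hN : 3 ≤ N) (g : SL(2, ℤ)) :
    g⁻¹ * ModularGroup.S * g ∉ Gamma1pm N := by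
  intro hmem
  have htr := trace_mem_gamma1pm N hmem
  rw [trace_conj_eq] at htr
  have hS : ((ModularGroup.S 0 0 : ℤ) + ModularGroup.S 1 1 : ℤ) = 0 := by
    simp [ModularGroup.S]
  rw [hS, Int.cast_zero] at htr
  have h2 : (2 : ZMod N) = 0 := by
    rcases htr with h | h
    · exact h.symm
    · have h' : (2 : ZMod N) = -0 := by rw [h, neg_neg]
      rw [h', neg_zero]
  have hdvd : N ∣ 2 := (ZMod.natCast_eq_zero_iff 2 N).mp (by exact_mod_cast h2)
  have := Nat.le_of_dvd (by norm_num) hdvd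
  omega

/-- **No conjugate of `ST` lies in `±Γ₁(N)` for `N ≥ 4`** (its trace is `1 ≢ ±2`): `±Γ₁(N)` has
no elliptic elements of order `3` or `6`. [cite: Shimura1971, §1.6 (Prop. 1.43: ν₃ = 0 for Γ₁(N), N ≥ 4)] -/
theorem conj_ST_not_mem_gamma1pm (hN : 4 ≤ N) (g : SL(2, ℤ)) :
    g⁻¹ * (ModularGroup.S * ModularGroup.T) * g ∉ Gamma1pm N := by
  intro hmem
  have htr := trace_mem_gamma1pm N hmem
  rw [trace_conj_eq] at htr
  have hST : (((ModularGroup.S * ModularGroup.T : SL(2, ℤ)) 0 0 : ℤ) +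
      (ModularGroup.S * ModularGroup.T : SL(2, ℤ)) 1 1 : ℤ) = 1 := by
    simp [ModularGroup.S, ModularGroup.T]
  rw [hST, Int.cast_one] at htr
  rcases htr with h | h
  · have h1 : (1 : ZMod N) = 0 := by linear_combination -h
    have hdvd : N ∣ 1 := (ZMod.natCast_eq_zero_iff 1 N).mp (by exact_mod_cast h1)
    have := Nat.le_of_dvd (by norm_num) hdvd
    omega
  · have h3 : (3 : ZMod N) = 0 := by linear_combination h
    have hdvd : N ∣ 3 := (ZMod.natCast_eq_zero_iff 3 N).mp (by exact_mod_cast h3)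
    have := Nat.le_of_dvd (by norm_num) hdvd
    omega

/-- **`ν₂ = 0` for `±Γ₁(N)`, `N ≥ 3`**: no coset of `SL₂(ℤ)/±Γ₁(N)` is fixed by `S`. [cite: Shimura1971, Prop. 1.43] -/
theorem card_fixed_S_gamma1pm (hN : 3 ≤ N) :
    Nat.card {q : SL(2, ℤ) ⧸ Gamma1pm N // ModularGroup.S • q = q} = 0 := by
  rw [Nat.card_eq_zero]
  left
  refine ⟨fun ⟨q, hq⟩ ↦ ?_⟩
  induction q using QuotientGroup.induction_on with
  | H g => exact conj_S_not_mem_gamma1pm N hN g ((smul_coset_eq_iff _ g).mp hq)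

/-- **`ν₃ = 0` for `±Γ₁(N)`, `N ≥ 4`**: no coset of `SL₂(ℤ)/±Γ₁(N)` is fixed by `ST`. [cite: Shimura1971, Prop. 1.43] -/
theorem card_fixed_ST_gamma1pm (hN : 4 ≤ N) :
    Nat.card {q : SL(2, ℤ) ⧸ Gamma1pm N // (ModularGroup.S * ModularGroup.T) • q = q} = 0 := by
  rw [Nat.card_eq_zero]
  left
  refine ⟨fun ⟨q, hq⟩ ↦ ?_⟩
  induction q using QuotientGroup.induction_on with
  | H g => exact conj_ST_not_mem_gamma1pm N hN g ((smul_coset_eq_iff _ g).mp hq)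

end Elliptic

end Literature.NumberTheory.EllipticCurves.ModularForms
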